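import Literature.MathematicalPhysics.QuantumLattice.SectorSpectrum
import Literature.MathematicalPhysics.QuantumLattice.LiebRobinsonFnwGapSpectralProofs
import HarnessLib

/-!
# A unique ground state in an invariant coordinate sector is gapped within the sector

Topic `MathematicalPhysics/QuantumLattice` (finite-dimensional spectral bookkeeping; consumer: the plaquette-boson
dictionary of the Hubbard summit, where uniqueness of the `(N, S^z) = (4, 0)` and `(2, 0)` plaquette ground states
(a certified / assumed datum) must be turned into a QUANTITATIVE statement — a gap above the ground energy on
the orthogonal complement of the ground state inside the sector — before it can be transported to the torus).
Everything is PROVED; no definition and no named fact is introduced: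

* `sector_gap_of_unique_groundState` — let `A` be Hermitian, `K = {v | v i = 0 for ¬p i}` a nonzero coordinate
  subspace left invariant by `A` (no entries from `p` to `¬p`, as in `sector_groundState`), and suppose the
  ground states of `A` in `K` (eigenvectors for the sector energy `minEnergyOn A K`) are unique up to scalars.
  Then there is `γ > 0` such that `(minEnergyOn A K + γ) ‖v‖² ≤ Re ⟨v, A v⟩` for every `v ∈ K` orthogonal to
  the ground states in `K` (the second variational principle inside the sector).

Proof: compress `A` to the sector (`B = A.submatrix val val`, Hermitian), identify `minEnergyOn A K` with
`B.groundEnergy` and the ground states (extension by zero / restriction, verbatim from `sector_groundState`),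
deduce `B.HasUniqueGroundState` (`finrank_eq_one_iff_of_nonzero'`), take the gap of
`exists_hasSpectralGap_of_hasUniqueGroundState` and apply `rayleigh_ge_of_hasSpectralGap_of_orthogonal`.

References: H. Tasaki, *Physics and Mathematics of Quantum Many-Body Systems* (2020), §2.1 (a unique ground state
of a finite system is accompanied by a nonzero gap; the variational principle) and §2.2 (working in a sector)
[cite: Tasaki2020, §2.1]; Reed–Simon IV, Thm. XIII.1. All statements are [folklore].
-/

noncomputable section

namespace Literature.MathematicalPhysics.QuantumLattice

open Matrix
open scoped ComplexOrder

section SectorGap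

variable {ι : Type*} [Fintype ι] [DecidableEq ι]

/-- **A unique sector ground state is gapped within its sector.** Let `A` be Hermitian and
`K = {v | v i = 0 for ¬p i}` a nonzero coordinate subspace which `A` leaves invariant, and suppose that any two
ground states of `A` in `K` (nonzero `v, w ∈ K` with `A v = E v`, `A w = E w`, `E = minEnergyOn A K`) are
proportional. Then for some `γ > 0`, every `v ∈ K` orthogonal to all ground states in `K` satisfies
`(E + γ) ‖v‖² ≤ Re⟨v, A v⟩`. Tasaki (2020) §2.1–2.2. [cite: Tasaki2020, §2.1] -/
theorem sector_gap_of_unique_groundState (A : Matrix ι ι ℂ) (hA : A.IsHermitian) (p : ι → Prop) [DecidablePred p]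
    (hp : ∃ i, p i) (hinv : ∀ i j, ¬ p i → p j → A i j = 0)
    (K : Submodule ℂ (ι → ℂ)) (hK : ∀ v, v ∈ K ↔ ∀ i, ¬ p i → v i = 0)
    (huniq : ∀ v ∈ K, ∀ w ∈ K, v ≠ 0 → A *ᵥ v = ((A.minEnergyOn K : ℝ) : ℂ) • v →
      A *ᵥ w = ((A.minEnergyOn K : ℝ) : ℂ) • w → ∃ c : ℂ, w = c • v) :
    ∃ γ : ℝ, 0 < γ ∧ ∀ v ∈ K, (∀ g ∈ K, A *ᵥ g = ((A.minEnergyOn K : ℝ) : ℂ) • g → star g ⬝ᵥ v = 0) →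
      (A.minEnergyOn K + γ) * (star v ⬝ᵥ v).re ≤ (star v ⬝ᵥ A *ᵥ v).re := by
  obtain ⟨i₀, hi₀⟩ := hp
  haveI : Nonempty (Subtype p) := ⟨⟨i₀, hi₀⟩⟩
  set B : Matrix (Subtype p) (Subtype p) ℂ := A.submatrix Subtype.val Subtype.val with hB
  have hBh : B.IsHermitian := hA.submatrix _
  -- extension by zero and restriction (as in `sector_groundState`)
  set ext : (Subtype p → ℂ) → (ι → ℂ) := fun φ i => if h : p i then φ ⟨i, h⟩ else 0 with hext
  set res : (ι → ℂ) → (Subtype p → ℂ) := fun v a => v a.1 with hres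
  have hext_apply : ∀ φ (a : Subtype p), ext φ a.1 = φ a := fun φ a => by simp [hext, a.2]
  have hext_not : ∀ φ i, ¬ p i → ext φ i = 0 := fun φ i hi => by simp [hext, hi]
  have hres_ext : ∀ φ, res (ext φ) = φ := fun φ => funext fun a => hext_apply φ a
  have hext_res : ∀ v ∈ K, ext (res v) = v := by
    intro v hv; funext i
    by_cases hi : p i
    · exact hext_apply (res v) ⟨i, hi⟩
    · rw [hext_not _ i hi, ((hK v).1 hv) i hi]
  have hext_mem : ∀ φ, ext φ ∈ K := fun φ => (hK _).2 fun i hi => hext_not φ i hi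
  have hext_smul : ∀ (c : ℂ) φ, ext (c • φ) = c • ext φ := by
    intro c φ; funext i; by_cases hi : p i <;> simp [hext, hi]
  have hres_smul : ∀ (c : ℂ) (v : ι → ℂ), res (c • v) = c • res v := fun c v => rfl
  have hext_inj : ∀ φ, ext φ = 0 → φ = 0 := fun φ h => by rw [← hres_ext φ, h]; rfl
  -- `A` acts on `K` as `B`
  have hAext : ∀ φ, A *ᵥ ext φ = ext (B *ᵥ φ) := by
    intro φ; funext i
    rw [mulVec, dotProduct]
    by_cases hi : p i
    · have h1 : ext (B *ᵥ φ) i = (B *ᵥ φ) ⟨i, hi⟩ := hext_apply (B *ᵥ φ) ⟨i, hi⟩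
      rw [h1, mulVec, dotProduct, sum_eq_sum_subtype_of_support p]
      · refine Finset.sum_congr rfl fun a _ => ?_
        rw [hext_apply]; rfl
      · intro j hj; rw [hext_not φ j hj, mul_zero]
    · rw [hext_not _ i hi]
      refine Finset.sum_eq_zero fun j _ => ?_
      by_cases hj : p j
      · rw [hinv i j hi hj, zero_mul]
      · rw [hext_not φ j hj, mul_zero]
  have hdot : ∀ φ (w : ι → ℂ), star (ext φ) ⬝ᵥ w = star φ ⬝ᵥ res w := by
    intro φ w
    rw [dotProduct, dotProduct, sum_eq_sum_subtype_of_support p]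
    · refine Finset.sum_congr rfl fun a _ => ?_
      rw [Pi.star_apply, Pi.star_apply, hext_apply]
    · intro j hj; rw [Pi.star_apply, hext_not φ j hj, star_zero, zero_mul]
  -- the Rayleigh sets coincide, hence `minEnergyOn A K = groundEnergy B`
  have hset : {E : ℝ | ∃ ψ ∈ K, star ψ ⬝ᵥ ψ = 1 ∧ E = (star ψ ⬝ᵥ A *ᵥ ψ).re} =
      {E : ℝ | ∃ φ ∈ (⊤ : Submodule ℂ (Subtype p → ℂ)), star φ ⬝ᵥ φ = 1 ∧ E = (star φ ⬝ᵥ B *ᵥ φ).re} := by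
    ext E
    constructor
    · rintro ⟨ψ, hψK, hψ1, rfl⟩
      refine ⟨res ψ, Submodule.mem_top, ?_, ?_⟩
      · rw [← hψ1, ← hext_res ψ hψK, hdot, hres_ext]
      · conv_lhs => rw [← hext_res ψ hψK, hAext, hdot, hres_ext]
    · rintro ⟨φ, -, hφ1, rfl⟩
      refine ⟨ext φ, hext_mem φ, ?_, ?_⟩
      · rw [hdot, hres_ext, hφ1]
      · rw [hAext, hdot, hres_ext]
  have hmin : A.minEnergyOn K = B.groundEnergy := by
    rw [Matrix.minEnergyOn, hset, ← Matrix.minEnergyOn_top_holds hBh]; rfl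
  -- a ground vector of `B`; its extension is a ground state of `A` in `K`
  obtain ⟨φ₀, hφ₀, hφ₀0⟩ := (Submodule.ne_bot_iff _).1 (Matrix.groundSpace_ne_bot_holds hBh)
  rw [Matrix.mem_groundSpace_iff] at hφ₀
  have hext_ground : ∀ φ, B *ᵥ φ = (B.groundEnergy : ℂ) • φ →
      A *ᵥ ext φ = ((A.minEnergyOn K : ℝ) : ℂ) • ext φ := by
    intro φ hφ
    rw [hAext, hφ, hmin, hext_smul]
  have hg₀ : A *ᵥ ext φ₀ = ((A.minEnergyOn K : ℝ) : ℂ) • ext φ₀ := hext_ground φ₀ hφ₀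
  have hg₀0 : ext φ₀ ≠ 0 := fun h => hφ₀0 (hext_inj φ₀ h)
  -- `B` has a unique ground state
  have huniqB : B.HasUniqueGroundState := by
    unfold Matrix.HasUniqueGroundState Matrix.groundStateDegeneracy
    rw [finrank_eq_one_iff_of_nonzero' (⟨φ₀, (Matrix.mem_groundSpace_iff B φ₀).2 hφ₀⟩ : B.groundSpace)
      (fun h => hφ₀0 (congrArg Subtype.val h))]
    rintro ⟨φ, hφ⟩
    rw [Matrix.mem_groundSpace_iff] at hφ
    obtain ⟨c, hc⟩ := huniq (ext φ₀) (hext_mem φ₀) (ext φ) (hext_mem φ) hg₀0 hg₀ (hext_ground φ hφ)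
    refine ⟨c, Subtype.ext ?_⟩
    show c • φ₀ = φ
    rw [← hres_ext φ, hc, ← hext_smul, hres_ext]
  obtain ⟨γ, hγ, hgap⟩ := exists_hasSpectralGap_of_hasUniqueGroundState hBh huniqB
  refine ⟨γ, hγ, fun v hv hperp => ?_⟩
  -- `res v ⊥ φ₀`
  have horth : star φ₀ ⬝ᵥ res v = 0 := by rw [← hdot]; exact hperp (ext φ₀) (hext_mem φ₀) hg₀
  have h := rayleigh_ge_of_hasSpectralGap_of_orthogonal hgap hφ₀0 hφ₀ horth
  have h1 : star (res v) ⬝ᵥ res v = star v ⬝ᵥ v := by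
    conv_rhs => rw [← hext_res v hv]
    rw [hdot, hres_ext]
  have h2 : star (res v) ⬝ᵥ B *ᵥ res v = star v ⬝ᵥ A *ᵥ v := by
    conv_rhs => rw [← hext_res v hv, hAext, hdot, hres_ext]
  rw [hmin, ← h1, ← h2]
  exact h

end SectorGap

end Literature.MathematicalPhysics.QuantumLattice
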